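import Literature.NumberTheory.Automorphic.ArchRankOneCasimirLadder             -- ★ p850639 (this seat, stage #1): the abstract ladder, `iterate_casimir_mem`, the concrete recursion heads; brings ★ Z4, ★ (R1G), ★ (K0±)-WEIGHTS
import Literature.NumberTheory.Automorphic.ArchLocalTorusOrbitalContinuity     -- ★ `integrable_comp_conj_circleDiagonal` (additivity of `F` on the regular set)
import HarnessLib

/-!
# ALL ORDERS at the central wall, stage #2: the CLOSED FORMS — odd jets continuous, even jets jump by the cone integrals of the iterated Casimir
# (Varadarajan 1989 §6.4 Thm 24: `F_f⁽²ᵏ⁺¹⁾ → (−1)ᵏ C·((1+Ω)ᵏf)(z·1)`, `F_f⁽²ᵏ⁾(0±) = ±(−1)ᵏ C₁·`half-cone`((1+Ω)ᵏf)`, over ★ stage #1 `ArchRankOneCasimirLadder`)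

Topic `NumberTheory/Automorphic`; namespace `Literature.NumberTheory.Automorphic.RankOneCasimir`.  THEOREMS ONLY (no `def`, no instance, no notation, no axiom, no named fact,
no `sorry`).  Cell `pub/hodgecm-mathlib`, line LH3 (closer stub `stub_N9`, crux H413 = `stmt-HodgeConjecture-24833`), brick **(ELL-∞) stage #2 of 2** (LH3-plan (g3) RULINGS #11 (2),
2026-09-02T08:45:47Z; stage #1 = ★ p850639): the one-place engine under letter L3′ (ii) `h2`∕(J) (LH3-p01 (g4) 08:40:46Z) and the elliptic half of the all-orders rank-one jump
junction (A0-CASIMIR-∞) (F0P3a-p09 (g6), «=» 08:51:42Z, consumes these heads BY NAME); author LH3-p04 (g4).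

THE MATHEMATICS (`G₂ = U((diag a).map σ_w) ≅ U(1,1)`, `μ` Haar, `z ∈ S¹`, `F_f(ψ) = 2 sin ψ · ∫_{G₂} f(↑↑(h t_z(ψ) h⁻¹)) dμ`, `Ω` the Casimir operator of ★ Z3∕Z4, `T = 1 + Ω`).
★ Stage #1 gives the ladder `F_f⁽ⁿ⁺²⁾ = −(F_f⁽ⁿ⁾ + F_{Ωf}⁽ⁿ⁾)` on `0 < |ψ| < 1` and one-sided limits of every jet.  Here: (§1) for any ladder family with `G (T f) = G f + G (Ω f)` on `U`
the CLOSED FORMS `G f⁽²ᵏ⁺¹⁾ → (−1)ᵏ • D (Tᵏ f)` (from `(G f)′ → D f`) and `G f⁽²ᵏ⁾ → (−1)ᵏ • Λ (Tᵏ f)` (from `G f → Λ f`) along any `l` — pure bookkeeping: `(G (Tf))⁽ⁿ⁾ = (G f)⁽ⁿ⁾ +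
(G (Ωf))⁽ⁿ⁾` on `U` and `−((−1)ᵏ D(Tᵏf) + (−1)ᵏ D(Tᵏ(Ωf))) = (−1)ᵏ⁺¹ D(Tᵏ(Tf))`; (§2) `F (f + g) = F f + F g` at every REGULAR `ψ` (`sin ψ ≠ 0`: both integrands are continuous
with compact support on `G₂` — ★ `integrable_comp_conj_circleDiagonal` over ★ `isCompact_setOf_coe_archLocal_mem`); (§3) the heads: with ★ (R1G)'s `C` (order 1, two-sided) the ODD
jets `F_f⁽²ᵏ⁺¹⁾ → (−1)ᵏ • C • ((1+Ω)ᵏ f)(z·1)` along `𝓝[≠] 0` — CONTINUOUS through the wall; with ★ (K0±)-WEIGHTS' `C₁` and half-cones (order 0, one-sided) the EVEN jets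
`F_f⁽²ᵏ⁾ → (−1)ᵏ • C₁ • ⁺half-cone((1+Ω)ᵏ f)` along `𝓝[>] 0` and `→ (−1)ᵏ • C₁ • −⁻half-cone((1+Ω)ᵏ f)` along `𝓝[<] 0`; (§4) for `E = ℂ` the ★-carpet `HasOneSidedJump` forms: jump `0` at
odd orders, jump `(−1)ᵏ C₁ ·` (full cone integral of `(1+Ω)ᵏ f`, both nappes) at order `2k` — Varadarajan's Thm 24 ∕ Bouaziz (I₃) at one place in the tree's currency (the Cayley
factor `iᵏ` and the matching with `∂_x^{2k}` of the split side are (A0-CASIMIR-∞)'s junction, not here).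
HONEST LABEL: HC_CM is proved only modulo the 7 printed citations (2 remaining: hLiu418 = stmt-HodgeConjecture-24832, h413 = stmt-HodgeConjecture-24833) until rung 0 closes;
elementary real analysis over ★ stage #1, count-neutral, pays nothing by itself.

WHAT IS PROVED.
* §1 `iteratedDeriv_add_of_ladder`, `tendsto_iteratedDeriv_odd_of_ladder`, `tendsto_iteratedDeriv_even_of_ladder` (abstract, group-free).
* §2 `orbitalIntegral_add_of_sin_ne_zero`.
* §3 **`exists_tendsto_iteratedDeriv_odd_orbitalIntegral`**, **`exists_tendsto_iteratedDeriv_even_orbitalIntegral_nhdsGT_nhdsLT`**.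
* §4 (`E = ℂ`) **`exists_hasOneSidedJump_iteratedDeriv_orbitalIntegral`** (odd: jump `0`; even: jump `(−1)ᵏ C₁ ·` full cone of `(1+Ω)ᵏ f`).

## References
* [Varadarajan1989] V. S. Varadarajan, *An Introduction to Harmonic Analysis on Semisimple Lie Groups*, Cambridge Stud. Adv. Math. 16 (1989), §6.3, §6.4 Lemma 21 (c), Thms 22–24.
* [Bouaziz1994IntegralesOrbitales] A. Bouaziz, *Intégrales orbitales sur les groupes de Lie réductifs*, Ann. Sci. ÉNS 27 (1994), §3.2 (I₃) p. 580.
* [Shelstad1979] D. Shelstad, *Characters and inner forms of a quasi-split group over ℝ*, Compositio Math. 39 (1979), Lemma 4.3 p. 25, Prop. 4.5 p. 26.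
* [Rogawski1990] J. D. Rogawski, *Automorphic Representations of Unitary Groups in Three Variables*, Ann. of Math. Stud. 123 (1990), §8.2 pp. 119–123.
-/

set_option autoImplicit false

noncomputable section

namespace Literature.NumberTheory.Automorphic.RankOneCasimir

open _root_.Complex _root_.Matrix _root_.MeasureTheory _root_.Set _root_.Filter _root_.Topology _root_.NumberField _root_.NumberField.InfinitePlace
open _root_.Literature.NumberTheory.Automorphic _root_.Literature.NumberTheory.Automorphic.UnitaryGroup
open _root_.Literature.NumberTheory.Automorphic.Shelstad1979.StableOrbitalIntegrals
open scoped Matrix.Norms.Operator MatrixGroups ComplexConjugate ContDiff Real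

/-! ## §1 Closed forms on the abstract ladder -/

section Ladder

variable {E : Type*} [NormedAddCommGroup E] [NormedSpace ℝ E]

/-- Additivity of the iterated derivatives of ladder members on `U`: if `G (T f) = G f + G (Ω f)` on `U`, then `(G (T f))⁽ⁿ⁾ = (G f)⁽ⁿ⁾ + (G (Ω f))⁽ⁿ⁾` on `U`.
[cite: Varadarajan1989, §6.4 Thm 24] -/
theorem iteratedDeriv_add_of_ladder {S : Type*} (Ω T : S → S) (G : S → ℝ → E) {U : Set ℝ} (hU : IsOpen U)
    (h : ∀ f, ∀ ψ ∈ U, HasDerivAt (G f) (deriv (G f) ψ) ψ ∧ HasDerivAt (deriv (G f)) (-(G f ψ + G (Ω f) ψ)) ψ)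
    (hT : ∀ f, ∀ ψ ∈ U, G (T f) ψ = G f ψ + G (Ω f) ψ) (n : ℕ) (f : S) {ψ : ℝ} (hψ : ψ ∈ U) :
    iteratedDeriv n (G (T f)) ψ = iteratedDeriv n (G f) ψ + iteratedDeriv n (G (Ω f)) ψ := by
  induction n generalizing ψ with
  | zero => simpa only [iteratedDeriv_zero] using hT f ψ hψ
  | succ n ih =>
    have hev : iteratedDeriv n (G (T f)) =ᶠ[𝓝 ψ] fun y => iteratedDeriv n (G f) y + iteratedDeriv n (G (Ω f)) y := by
      filter_upwards [hU.mem_nhds hψ] with y hy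
      exact ih hy
    rw [iteratedDeriv_succ, hev.deriv_eq]
    exact (((hasDerivAt_iteratedDeriv_and_ladder Ω G hU h n f hψ).1).add ((hasDerivAt_iteratedDeriv_and_ladder Ω G hU h n (Ω f) hψ).1)).deriv

/-- **Closed form, ODD jets**: if `(G f)′ → D f` along `l` for every `f`, and `G (T f) = G f + G (Ω f)` on `U` (`T = 1 + Ω`), then `(G f)⁽²ᵏ⁺¹⁾ → (−1)ᵏ • D (Tᵏ f)` along `l`.
[cite: Varadarajan1989, §6.4 Thm 24] -/
theorem tendsto_iteratedDeriv_odd_of_ladder {S : Type*} (Ω T : S → S) (G : S → ℝ → E) {U : Set ℝ} (hU : IsOpen U)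
    (h : ∀ f, ∀ ψ ∈ U, HasDerivAt (G f) (deriv (G f) ψ) ψ ∧ HasDerivAt (deriv (G f)) (-(G f ψ + G (Ω f) ψ)) ψ)
    (hT : ∀ f, ∀ ψ ∈ U, G (T f) ψ = G f ψ + G (Ω f) ψ) {l : Filter ℝ} [NeBot l] (hl : ∀ᶠ ψ in l, ψ ∈ U)
    {D : S → E} (hD : ∀ f, Tendsto (fun ψ => deriv (G f) ψ) l (𝓝 (D f))) (k : ℕ) (f : S) :
    Tendsto (fun ψ => iteratedDeriv (2 * k + 1) (G f) ψ) l (𝓝 (((-1 : ℝ) ^ k) • D (T^[k] f))) := by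
  induction k generalizing f with
  | zero => simpa only [Nat.mul_zero, zero_add, iteratedDeriv_one, pow_zero, one_smul, Function.iterate_zero, id_eq] using hD f
  | succ k ih =>
    have hsum : Tendsto (fun ψ => iteratedDeriv (2 * k + 1) (G f) ψ + iteratedDeriv (2 * k + 1) (G (Ω f)) ψ) l (𝓝 (((-1 : ℝ) ^ k) • D (T^[k] (T f)))) := by
      refine (ih (T f)).congr' ?_
      filter_upwards [hl] with ψ hψ
      exact iteratedDeriv_add_of_ladder Ω T G hU h hT (2 * k + 1) f hψ
    have hrec := tendsto_iteratedDeriv_add_two_of_ladder Ω G hU h hl (2 * k + 1) f (ih f) (ih (Ω f))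
    have hlim : -((((-1 : ℝ) ^ k) • D (T^[k] f)) + (((-1 : ℝ) ^ k) • D (T^[k] (Ω f)))) = ((-1 : ℝ) ^ (k + 1)) • D (T^[k + 1] f) := by
      have huniq := tendsto_nhds_unique ((ih f).add (ih (Ω f))) hsum
      rw [huniq, Function.iterate_succ_apply, pow_succ, mul_neg_one, neg_smul]
    rw [show 2 * (k + 1) + 1 = 2 * k + 1 + 2 by ring, ← hlim]
    exact hrec

/-- **Closed form, EVEN jets**: if `G f → Λ f` along `l` for every `f`, and `G (T f) = G f + G (Ω f)` on `U`, then `(G f)⁽²ᵏ⁾ → (−1)ᵏ • Λ (Tᵏ f)` along `l`.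
[cite: Varadarajan1989, §6.4 Thm 24] -/
theorem tendsto_iteratedDeriv_even_of_ladder {S : Type*} (Ω T : S → S) (G : S → ℝ → E) {U : Set ℝ} (hU : IsOpen U)
    (h : ∀ f, ∀ ψ ∈ U, HasDerivAt (G f) (deriv (G f) ψ) ψ ∧ HasDerivAt (deriv (G f)) (-(G f ψ + G (Ω f) ψ)) ψ)
    (hT : ∀ f, ∀ ψ ∈ U, G (T f) ψ = G f ψ + G (Ω f) ψ) {l : Filter ℝ} [NeBot l] (hl : ∀ᶠ ψ in l, ψ ∈ U)
    {Λ : S → E} (hΛ : ∀ f, Tendsto (G f) l (𝓝 (Λ f))) (k : ℕ) (f : S) :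
    Tendsto (fun ψ => iteratedDeriv (2 * k) (G f) ψ) l (𝓝 (((-1 : ℝ) ^ k) • Λ (T^[k] f))) := by
  induction k generalizing f with
  | zero => simpa only [Nat.mul_zero, iteratedDeriv_zero, pow_zero, one_smul, Function.iterate_zero, id_eq] using hΛ f
  | succ k ih =>
    have hsum : Tendsto (fun ψ => iteratedDeriv (2 * k) (G f) ψ + iteratedDeriv (2 * k) (G (Ω f)) ψ) l (𝓝 (((-1 : ℝ) ^ k) • Λ (T^[k] (T f)))) := by
      refine (ih (T f)).congr' ?_
      filter_upwards [hl] with ψ hψ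
      exact iteratedDeriv_add_of_ladder Ω T G hU h hT (2 * k) f hψ
    have hrec := tendsto_iteratedDeriv_add_two_of_ladder Ω G hU h hl (2 * k) f (ih f) (ih (Ω f))
    have hlim : -((((-1 : ℝ) ^ k) • Λ (T^[k] f)) + (((-1 : ℝ) ^ k) • Λ (T^[k] (Ω f)))) = ((-1 : ℝ) ^ (k + 1)) • Λ (T^[k + 1] f) := by
      have huniq := tendsto_nhds_unique ((ih f).add (ih (Ω f))) hsum
      rw [huniq, Function.iterate_succ_apply, pow_succ, mul_neg_one, neg_smul]
    rw [show 2 * (k + 1) = 2 * k + 2 by ring, ← hlim]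
    exact hrec

end Ladder

/-! ## §2 Additivity of the normalised orbital integral on the regular set (`sin ψ ≠ 0`: the integrands are integrable) -/

section Additive

variable (L : Type) [Field L] (a : Fin 2 → L) (w : {w : InfinitePlace L // IsComplex w})
variable {E : Type*} [NormedAddCommGroup E] [NormedSpace ℝ E]

/-- **`F (f + g) ψ = F f ψ + F g ψ` at a REGULAR torus point** (`sin ψ ≠ 0`): the integrands `h ↦ f(↑↑(h t_z(ψ) h⁻¹))` are continuous with compact support on `G₂`
(★ `integrable_comp_conj_circleDiagonal` over ★ `isCompact_setOf_coe_archLocal_mem`), so the integral is additive.  (At `sin ψ = 0` both sides are `0 • junk = 0`, not needed.)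
[cite: Rogawski1990, §8.2 p. 122] [cite: Varadarajan1989, §6.4] -/
theorem orbitalIntegral_add_of_sin_ne_zero (ha : ∀ i, a i ≠ 0)
    [MeasurableSpace (unitaryGroupOfForm (starRingEnd ℂ) ((Matrix.diagonal a).map w.1.embedding))]
    [BorelSpace (unitaryGroupOfForm (starRingEnd ℂ) ((Matrix.diagonal a).map w.1.embedding))]
    (μ : Measure (unitaryGroupOfForm (starRingEnd ℂ) ((Matrix.diagonal a).map w.1.embedding))) [IsFiniteMeasureOnCompacts μ]
    (z : Circle) (F : (Matrix (Fin 2) (Fin 2) ℂ → E) → ℝ → E)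
    (hF : ∀ (g : Matrix (Fin 2) (Fin 2) ℂ → E) (ψ : ℝ), F g ψ = (2 * Real.sin ψ) •
      ∫ h : unitaryGroupOfForm (starRingEnd ℂ) ((Matrix.diagonal a).map w.1.embedding),
        g (((h * ⟨circleDiagonal 2 ![z * Circle.exp ψ, z * Circle.exp (-ψ)], circleDiagonal_mem_archLocal_diagonal L 2 a w _⟩ * h⁻¹ :
          unitaryGroupOfForm (starRingEnd ℂ) ((Matrix.diagonal a).map w.1.embedding)) : GL (Fin 2) ℂ) : Matrix (Fin 2) (Fin 2) ℂ) ∂μ)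
    {f g : Matrix (Fin 2) (Fin 2) ℂ → E} (hf : Continuous f) (hfc : HasCompactSupport f) (hg : Continuous g) (hgc : HasCompactSupport g)
    {ψ : ℝ} (hψ : Real.sin ψ ≠ 0) : F (f + g) ψ = F f ψ + F g ψ := by
  -- bridge the instances to the `archLocal L 2 (diag a) w` spelling (`rfl`)
  have hfin : IsFiniteMeasureOnCompacts μ := inferInstance
  letI iA : MeasurableSpace (archLocal L 2 (Matrix.diagonal a) w) :=
    ‹MeasurableSpace (unitaryGroupOfForm (starRingEnd ℂ) ((Matrix.diagonal a).map w.1.embedding))›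
  haveI : BorelSpace (archLocal L 2 (Matrix.diagonal a) w) := ‹BorelSpace (unitaryGroupOfForm (starRingEnd ℂ) ((Matrix.diagonal a).map w.1.embedding))›
  haveI : @IsFiniteMeasureOnCompacts (archLocal L 2 (Matrix.diagonal a) w) iA _ μ := hfin
  have hz : Function.Injective (![z * Circle.exp ψ, z * Circle.exp (-ψ)] : Fin 2 → Circle) := by
    intro i j hij
    fin_cases i <;> fin_cases j
    · rfl
    · exact absurd hij (torusPoint_ne z hψ)
    · exact absurd hij.symm (torusPoint_ne z hψ)
    · rfl
  have hcoe : Continuous fun x : archLocal L 2 (Matrix.diagonal a) w => ((x : GL (Fin 2) ℂ) : Matrix (Fin 2) (Fin 2) ℂ) :=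
    Units.continuous_val.comp continuous_subtype_val
  have hint : ∀ {φ : Matrix (Fin 2) (Fin 2) ℂ → E}, Continuous φ → HasCompactSupport φ →
      Integrable (fun h : archLocal L 2 (Matrix.diagonal a) w =>
        φ (((h * ⟨circleDiagonal 2 ![z * Circle.exp ψ, z * Circle.exp (-ψ)], circleDiagonal_mem_archLocal_diagonal L 2 a w _⟩ * h⁻¹ :
          archLocal L 2 (Matrix.diagonal a) w) : GL (Fin 2) ℂ) : Matrix (Fin 2) (Fin 2) ℂ)) μ := by
    intro φ hφ hφc
    have hK := isCompact_setOf_coe_archLocal_mem L 2 a w ha hφc.isCompact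
    exact integrable_comp_conj_circleDiagonal L 2 a w ha μ hz (fun x : archLocal L 2 (Matrix.diagonal a) w => φ ((x : GL (Fin 2) ℂ) : Matrix (Fin 2) (Fin 2) ℂ))
      (hφ.comp hcoe) (HasCompactSupport.intro hK fun x hx => image_eq_zero_of_notMem_tsupport hx)
  rw [hF, hF, hF, ← smul_add]
  congr 1
  exact integral_add (hint hf hfc) (hint hg hgc)

end Additive

/-! ## §3 Closed forms: ODD jets are continuous at the wall, EVEN jets jump — with the explicit iterated-Casimir values -/

section ClosedForms

variable (L : Type) [Field L] (a : Fin 2 → L) (w : {w : InfinitePlace L // IsComplex w})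
variable {E : Type*} [NormedAddCommGroup E] [NormedSpace ℝ E] [CompleteSpace E]

/-- **ODD JETS ARE CONTINUOUS AT THE WALL, WITH THEIR VALUES**: one `C ≠ 0` (★ (R1G)'s, depends on `μ` only) such that for every `z ∈ S¹`, `f ∈ C_c^∞(M₂(ℂ), E)` and `k`,
`(F f)⁽²ᵏ⁺¹⁾ → (−1)ᵏ • C • ((1+Ω)ᵏ f)(z·1)` along `𝓝[≠] 0` (TWO-sided: no jump at odd orders) — Varadarajan's Thm 24 «`∂^{2k+1} F_f` is continuous at `1` with value `∝ ((1+Ω)ᵏf)(1)`».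
[cite: Varadarajan1989, §6.4 Thm 24] [cite: Shelstad1979, Prop. 4.5 p. 26] [cite: Bouaziz1994IntegralesOrbitales, §3.2 (I₃) p. 580] -/
theorem exists_tendsto_iteratedDeriv_odd_orbitalIntegral
    (ha : ∀ i, a i ≠ 0) (hreal : ∀ i, (w.1.embedding (a i)).im = 0) (hsgn : (w.1.embedding (a 0)).re * (w.1.embedding (a 1)).re < 0)
    {p q : ℝ} (hpq : p * q = 1) (hqe : (q : ℂ) ^ 2 * w.1.embedding (a 1) = -w.1.embedding (a 0))
    [MeasurableSpace (unitaryGroupOfForm (starRingEnd ℂ) ((Matrix.diagonal a).map w.1.embedding))]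
    [BorelSpace (unitaryGroupOfForm (starRingEnd ℂ) ((Matrix.diagonal a).map w.1.embedding))]
    (μ : Measure (unitaryGroupOfForm (starRingEnd ℂ) ((Matrix.diagonal a).map w.1.embedding))) [μ.IsHaarMeasure] [μ.IsMulRightInvariant]
    (Ω : (Matrix (Fin 2) (Fin 2) ℂ → E) → Matrix (Fin 2) (Fin 2) ℂ → E)
    (hΩ : ∀ (g : Matrix (Fin 2) (Fin 2) ℂ → E) (Y : Matrix (Fin 2) (Fin 2) ℂ), Ω g Y =
      -(fderiv ℝ (fderiv ℝ g) Y (Y * !![I, 0; 0, -I]) (Y * !![I, 0; 0, -I]) + fderiv ℝ g Y (Y * !![I, 0; 0, -I] * !![I, 0; 0, -I])) +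
        (fderiv ℝ (fderiv ℝ g) Y (Y * !![(0 : ℂ), (p : ℂ); (q : ℂ), 0]) (Y * !![(0 : ℂ), (p : ℂ); (q : ℂ), 0]) +
          fderiv ℝ g Y (Y * !![(0 : ℂ), (p : ℂ); (q : ℂ), 0] * !![(0 : ℂ), (p : ℂ); (q : ℂ), 0])) +
        (fderiv ℝ (fderiv ℝ g) Y (Y * !![(0 : ℂ), -((p : ℂ) * I); (q : ℂ) * I, 0]) (Y * !![(0 : ℂ), -((p : ℂ) * I); (q : ℂ) * I, 0]) +
          fderiv ℝ g Y (Y * !![(0 : ℂ), -((p : ℂ) * I); (q : ℂ) * I, 0] * !![(0 : ℂ), -((p : ℂ) * I); (q : ℂ) * I, 0]))) :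
    ∃ C : ℝ, C ≠ 0 ∧ ∀ (z : Circle) (F : (Matrix (Fin 2) (Fin 2) ℂ → E) → ℝ → E)
    (hF : ∀ (g : Matrix (Fin 2) (Fin 2) ℂ → E) (ψ : ℝ), F g ψ = (2 * Real.sin ψ) •
      ∫ h : unitaryGroupOfForm (starRingEnd ℂ) ((Matrix.diagonal a).map w.1.embedding),
        g (((h * ⟨circleDiagonal 2 ![z * Circle.exp ψ, z * Circle.exp (-ψ)], circleDiagonal_mem_archLocal_diagonal L 2 a w _⟩ * h⁻¹ :
          unitaryGroupOfForm (starRingEnd ℂ) ((Matrix.diagonal a).map w.1.embedding)) : GL (Fin 2) ℂ) : Matrix (Fin 2) (Fin 2) ℂ) ∂μ)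
      {f : Matrix (Fin 2) (Fin 2) ℂ → E}, ContDiff ℝ ∞ f → HasCompactSupport f → ∀ k : ℕ,
        Tendsto (fun ψ => iteratedDeriv (2 * k + 1) (F f) ψ) (𝓝[≠] 0)
          (𝓝 (((-1 : ℝ) ^ k) • C • ((fun g => g + Ω g)^[k] f) ((z : ℂ) • (1 : Matrix (Fin 2) (Fin 2) ℂ)))) := by
  obtain ⟨C, hC, hZ⟩ := exists_tendsto_iteratedDeriv_three_orbitalIntegral (E := E) L a w ha hreal hsgn hpq hqe μ
  refine ⟨C, hC, fun z F hF f hf hfc k => ?_⟩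
  have hmem : Ioo (-1 : ℝ) 1 ∩ {(0 : ℝ)}ᶜ ∈ 𝓝[≠] (0 : ℝ) :=
    inter_mem (mem_nhdsWithin_of_mem_nhds (Ioo_mem_nhds (by norm_num) (by norm_num))) self_mem_nhdsWithin
  have hU : ∀ ψ ∈ Ioo (-1 : ℝ) 1, ψ ≠ 0 → Real.sin ψ ≠ 0 := fun ψ hψ hψ0 hs =>
    hψ0 ((Real.sin_eq_zero_iff_of_lt_of_lt (by linarith [hψ.1, Real.pi_gt_three]) (by linarith [hψ.2, Real.pi_gt_three])).1 hs)
  -- the ladder data on the subtype `C_c^∞`: `Ω′`, `T′ = 1 + Ω′`, `G g = F g`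
  have key := tendsto_iteratedDeriv_odd_of_ladder (S := {g : Matrix (Fin 2) (Fin 2) ℂ → E // ContDiff ℝ ∞ g ∧ HasCompactSupport g})
    (fun g => ⟨Ω g.1, contDiff_casimir p q Ω hΩ g.2.1, hasCompactSupport_casimir p q Ω hΩ g.2.2⟩)
    (fun g => ⟨g.1 + Ω g.1, g.2.1.add (contDiff_casimir p q Ω hΩ g.2.1), g.2.2.add (hasCompactSupport_casimir p q Ω hΩ g.2.2)⟩)
    (fun g => F g.1) (U := Ioo (-1 : ℝ) 1 ∩ {(0 : ℝ)}ᶜ) (isOpen_Ioo.inter isOpen_compl_singleton) ?_ ?_ (l := 𝓝[≠] (0 : ℝ)) hmem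
    (D := fun g => C • g.1 ((z : ℂ) • (1 : Matrix (Fin 2) (Fin 2) ℂ)))
    (fun g => (hZ g.1 (g.2.1.of_le (WithTop.coe_le_coe.2 le_top)) g.2.2 (Ω g.1) (hΩ g.1) z F hF).1) k ⟨f, hf, hfc⟩
  · -- `(T′ᵏ g).1 = (1+Ω)ᵏ g.1`
    have hval : ∀ (k : ℕ) (g : {g : Matrix (Fin 2) (Fin 2) ℂ → E // ContDiff ℝ ∞ g ∧ HasCompactSupport g}),
        ((fun g : {g : Matrix (Fin 2) (Fin 2) ℂ → E // ContDiff ℝ ∞ g ∧ HasCompactSupport g} =>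
          (⟨g.1 + Ω g.1, g.2.1.add (contDiff_casimir p q Ω hΩ g.2.1), g.2.2.add (hasCompactSupport_casimir p q Ω hΩ g.2.2)⟩ :
            {g : Matrix (Fin 2) (Fin 2) ℂ → E // ContDiff ℝ ∞ g ∧ HasCompactSupport g}))^[k] g).1 = (fun g => g + Ω g)^[k] g.1 :=
      fun k g => (Function.Semiconj.iterate_right (f := Subtype.val) (fun _ => rfl) k).eq g
    simpa only [hval] using key
  · rintro ⟨g, hg, hgc⟩ ψ ⟨hψ, hψ0⟩
    obtain ⟨-, -, hlad, -⟩ := hZ g (hg.of_le (WithTop.coe_le_coe.2 le_top)) hgc (Ω g) (hΩ g) z F hF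
    obtain ⟨h1, -, h2⟩ := hlad ψ hψ hψ0
    exact ⟨h1, h2⟩
  · rintro ⟨g, hg, hgc⟩ ψ ⟨hψ, hψ0⟩
    exact orbitalIntegral_add_of_sin_ne_zero L a w ha μ z F hF hg.continuous hgc (contDiff_casimir p q Ω hΩ hg).continuous
      (hasCompactSupport_casimir p q Ω hΩ hgc) (hU ψ hψ hψ0)

/-- **EVEN JETS: THE ONE-SIDED VALUES AT THE WALL**: one `C₁ > 0` (★ (K0±)'s, depends on `μ` only) such that for every `z ∈ S¹`, `f ∈ C_c^∞(M₂(ℂ), E)` and `k`,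
`(F f)⁽²ᵏ⁾ → (−1)ᵏ • C₁ •` (the `⁺`half-cone integral of `(1+Ω)ᵏ f` at `z·1`) along `𝓝[>] 0` and `→ (−1)ᵏ • C₁ • −`(the `⁻`half-cone integral) along `𝓝[<] 0` (★ (K0±)-WEIGHTS'
values VERBATIM with `f ↦ (1+Ω)ᵏ f`) — Varadarajan's Thm 24 «`∂^{2k}F_f` jumps at `1` by Rao's cone integral of `(1+Ω)ᵏ f`».
[cite: Varadarajan1989, §6.4 Lemma 21 (c), Thms 23–24] [cite: Shelstad1979, Lemma 4.3 p. 25] [cite: Rogawski1990, §8.2 p. 119] -/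
theorem exists_tendsto_iteratedDeriv_even_orbitalIntegral_nhdsGT_nhdsLT
    (ha : ∀ i, a i ≠ 0) (hreal : ∀ i, (w.1.embedding (a i)).im = 0) (hsgn : (w.1.embedding (a 0)).re * (w.1.embedding (a 1)).re < 0)
    {p q : ℝ} (hpq : p * q = 1) (hqe : (q : ℂ) ^ 2 * w.1.embedding (a 1) = -w.1.embedding (a 0))
    [MeasurableSpace (unitaryGroupOfForm (starRingEnd ℂ) ((Matrix.diagonal a).map w.1.embedding))]
    [BorelSpace (unitaryGroupOfForm (starRingEnd ℂ) ((Matrix.diagonal a).map w.1.embedding))]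
    (μ : Measure (unitaryGroupOfForm (starRingEnd ℂ) ((Matrix.diagonal a).map w.1.embedding))) [μ.IsHaarMeasure] [μ.IsMulRightInvariant]
    (Ω : (Matrix (Fin 2) (Fin 2) ℂ → E) → Matrix (Fin 2) (Fin 2) ℂ → E)
    (hΩ : ∀ (g : Matrix (Fin 2) (Fin 2) ℂ → E) (Y : Matrix (Fin 2) (Fin 2) ℂ), Ω g Y =
      -(fderiv ℝ (fderiv ℝ g) Y (Y * !![I, 0; 0, -I]) (Y * !![I, 0; 0, -I]) + fderiv ℝ g Y (Y * !![I, 0; 0, -I] * !![I, 0; 0, -I])) +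
        (fderiv ℝ (fderiv ℝ g) Y (Y * !![(0 : ℂ), (p : ℂ); (q : ℂ), 0]) (Y * !![(0 : ℂ), (p : ℂ); (q : ℂ), 0]) +
          fderiv ℝ g Y (Y * !![(0 : ℂ), (p : ℂ); (q : ℂ), 0] * !![(0 : ℂ), (p : ℂ); (q : ℂ), 0])) +
        (fderiv ℝ (fderiv ℝ g) Y (Y * !![(0 : ℂ), -((p : ℂ) * I); (q : ℂ) * I, 0]) (Y * !![(0 : ℂ), -((p : ℂ) * I); (q : ℂ) * I, 0]) +
          fderiv ℝ g Y (Y * !![(0 : ℂ), -((p : ℂ) * I); (q : ℂ) * I, 0] * !![(0 : ℂ), -((p : ℂ) * I); (q : ℂ) * I, 0]))) :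
    ∃ C₁ : ℝ, 0 < C₁ ∧ ∀ (z : Circle) (F : (Matrix (Fin 2) (Fin 2) ℂ → E) → ℝ → E)
    (hF : ∀ (g : Matrix (Fin 2) (Fin 2) ℂ → E) (ψ : ℝ), F g ψ = (2 * Real.sin ψ) •
      ∫ h : unitaryGroupOfForm (starRingEnd ℂ) ((Matrix.diagonal a).map w.1.embedding),
        g (((h * ⟨circleDiagonal 2 ![z * Circle.exp ψ, z * Circle.exp (-ψ)], circleDiagonal_mem_archLocal_diagonal L 2 a w _⟩ * h⁻¹ :
          unitaryGroupOfForm (starRingEnd ℂ) ((Matrix.diagonal a).map w.1.embedding)) : GL (Fin 2) ℂ) : Matrix (Fin 2) (Fin 2) ℂ) ∂μ)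
      {f : Matrix (Fin 2) (Fin 2) ℂ → E}, ContDiff ℝ ∞ f → HasCompactSupport f → ∀ k : ℕ,
        Tendsto (fun ψ => iteratedDeriv (2 * k) (F f) ψ) (𝓝[>] 0)
          (𝓝 (((-1 : ℝ) ^ k) • C₁ • ∫ p in Ioi (0 : ℝ) ×ˢ Ioc (0 : ℝ) (2 * π),
            ((fun g => g + Ω g)^[k] f) (Matrix.diagonal ![(((Real.sqrt |(w.1.embedding (a 0)).re|)⁻¹ : ℝ) : ℂ), (((Real.sqrt |(w.1.embedding (a 1)).re|)⁻¹ : ℝ) : ℂ)] *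
              ((z : ℂ) • (1 : Matrix (Fin 2) (Fin 2) ℂ) + p.1 • Matrix.diagonal ![(z : ℂ) * I, -((z : ℂ) * I)] +
                p.1 • !![(0 : ℂ), -((z : ℂ) * I) * cexp (-((p.2 : ℂ) * I)); ((z : ℂ) * I) * cexp ((p.2 : ℂ) * I), 0]) *
              Matrix.diagonal ![((Real.sqrt |(w.1.embedding (a 0)).re| : ℝ) : ℂ), ((Real.sqrt |(w.1.embedding (a 1)).re| : ℝ) : ℂ)]))) ∧
        Tendsto (fun ψ => iteratedDeriv (2 * k) (F f) ψ) (𝓝[<] 0)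
          (𝓝 (((-1 : ℝ) ^ k) • C₁ • -(∫ p in Ioi (0 : ℝ) ×ˢ Ioc (0 : ℝ) (2 * π),
            ((fun g => g + Ω g)^[k] f) (Matrix.diagonal ![(((Real.sqrt |(w.1.embedding (a 0)).re|)⁻¹ : ℝ) : ℂ), (((Real.sqrt |(w.1.embedding (a 1)).re|)⁻¹ : ℝ) : ℂ)] *
              ((z : ℂ) • (1 : Matrix (Fin 2) (Fin 2) ℂ) + p.1 • Matrix.diagonal ![-((z : ℂ) * I), (z : ℂ) * I] +
                p.1 • !![(0 : ℂ), ((z : ℂ) * I) * cexp (-((p.2 : ℂ) * I)); -((z : ℂ) * I) * cexp ((p.2 : ℂ) * I), 0]) *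
              Matrix.diagonal ![((Real.sqrt |(w.1.embedding (a 0)).re| : ℝ) : ℂ), ((Real.sqrt |(w.1.embedding (a 1)).re| : ℝ) : ℂ)])))) := by
  obtain ⟨C, -, hZ⟩ := exists_tendsto_iteratedDeriv_three_orbitalIntegral (E := E) L a w ha hreal hsgn hpq hqe μ
  obtain ⟨C₁, hC₁, hK⟩ := exists_tendsto_two_sin_smul_orbitalIntegral_nhdsGT_nhdsLT_weights (E := E) w.1.embedding a hreal hsgn μ
  refine ⟨C₁, hC₁, fun z F hF f hf hfc k => ?_⟩
  have hmem : Ioo (-1 : ℝ) 1 ∩ {(0 : ℝ)}ᶜ ∈ 𝓝[≠] (0 : ℝ) :=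
    inter_mem (mem_nhdsWithin_of_mem_nhds (Ioo_mem_nhds (by norm_num) (by norm_num))) self_mem_nhdsWithin
  have hU : ∀ ψ ∈ Ioo (-1 : ℝ) 1, ψ ≠ 0 → Real.sin ψ ≠ 0 := fun ψ hψ hψ0 hs =>
    hψ0 ((Real.sin_eq_zero_iff_of_lt_of_lt (by linarith [hψ.1, Real.pi_gt_three]) (by linarith [hψ.2, Real.pi_gt_three])).1 hs)
  have hlad : ∀ g : {g : Matrix (Fin 2) (Fin 2) ℂ → E // ContDiff ℝ ∞ g ∧ HasCompactSupport g}, ∀ ψ ∈ Ioo (-1 : ℝ) 1 ∩ {(0 : ℝ)}ᶜ,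
      HasDerivAt ((fun g : {g : Matrix (Fin 2) (Fin 2) ℂ → E // ContDiff ℝ ∞ g ∧ HasCompactSupport g} => F g.1) g)
          (deriv ((fun g : {g : Matrix (Fin 2) (Fin 2) ℂ → E // ContDiff ℝ ∞ g ∧ HasCompactSupport g} => F g.1) g) ψ) ψ ∧
        HasDerivAt (deriv ((fun g : {g : Matrix (Fin 2) (Fin 2) ℂ → E // ContDiff ℝ ∞ g ∧ HasCompactSupport g} => F g.1) g))
          (-((fun g : {g : Matrix (Fin 2) (Fin 2) ℂ → E // ContDiff ℝ ∞ g ∧ HasCompactSupport g} => F g.1) g ψ +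
            (fun g : {g : Matrix (Fin 2) (Fin 2) ℂ → E // ContDiff ℝ ∞ g ∧ HasCompactSupport g} => F g.1)
              ((fun g => ⟨Ω g.1, contDiff_casimir p q Ω hΩ g.2.1, hasCompactSupport_casimir p q Ω hΩ g.2.2⟩) g) ψ)) ψ := by
    rintro ⟨g, hg, hgc⟩ ψ ⟨hψ, hψ0⟩
    obtain ⟨-, -, hlad, -⟩ := hZ g (hg.of_le (WithTop.coe_le_coe.2 le_top)) hgc (Ω g) (hΩ g) z F hF
    obtain ⟨h1, -, h2⟩ := hlad ψ hψ hψ0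
    exact ⟨h1, h2⟩
  have hT : ∀ g : {g : Matrix (Fin 2) (Fin 2) ℂ → E // ContDiff ℝ ∞ g ∧ HasCompactSupport g}, ∀ ψ ∈ Ioo (-1 : ℝ) 1 ∩ {(0 : ℝ)}ᶜ,
      (fun g : {g : Matrix (Fin 2) (Fin 2) ℂ → E // ContDiff ℝ ∞ g ∧ HasCompactSupport g} => F g.1)
          ((fun g : {g : Matrix (Fin 2) (Fin 2) ℂ → E // ContDiff ℝ ∞ g ∧ HasCompactSupport g} =>
            (⟨g.1 + Ω g.1, g.2.1.add (contDiff_casimir p q Ω hΩ g.2.1), g.2.2.add (hasCompactSupport_casimir p q Ω hΩ g.2.2)⟩ :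
              {g : Matrix (Fin 2) (Fin 2) ℂ → E // ContDiff ℝ ∞ g ∧ HasCompactSupport g})) g) ψ =
        (fun g : {g : Matrix (Fin 2) (Fin 2) ℂ → E // ContDiff ℝ ∞ g ∧ HasCompactSupport g} => F g.1) g ψ +
          (fun g : {g : Matrix (Fin 2) (Fin 2) ℂ → E // ContDiff ℝ ∞ g ∧ HasCompactSupport g} => F g.1)
            ((fun g => ⟨Ω g.1, contDiff_casimir p q Ω hΩ g.2.1, hasCompactSupport_casimir p q Ω hΩ g.2.2⟩) g) ψ := by
    rintro ⟨g, hg, hgc⟩ ψ ⟨hψ, hψ0⟩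
    exact orbitalIntegral_add_of_sin_ne_zero L a w ha μ z F hF hg.continuous hgc (contDiff_casimir p q Ω hΩ hg).continuous
      (hasCompactSupport_casimir p q Ω hΩ hgc) (hU ψ hψ hψ0)
  have hval : ∀ (k : ℕ) (g : {g : Matrix (Fin 2) (Fin 2) ℂ → E // ContDiff ℝ ∞ g ∧ HasCompactSupport g}),
      ((fun g : {g : Matrix (Fin 2) (Fin 2) ℂ → E // ContDiff ℝ ∞ g ∧ HasCompactSupport g} =>
        (⟨g.1 + Ω g.1, g.2.1.add (contDiff_casimir p q Ω hΩ g.2.1), g.2.2.add (hasCompactSupport_casimir p q Ω hΩ g.2.2)⟩ :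
          {g : Matrix (Fin 2) (Fin 2) ℂ → E // ContDiff ℝ ∞ g ∧ HasCompactSupport g}))^[k] g).1 = (fun g => g + Ω g)^[k] g.1 :=
    fun k g => (Function.Semiconj.iterate_right (f := Subtype.val) (fun _ => rfl) k).eq g
  -- the order-0 one-sided values (★ (K0±)-WEIGHTS) for every member of the subtype, in the `F` spelling
  have hFg : ∀ g : Matrix (Fin 2) (Fin 2) ℂ → E, F g = fun ψ : ℝ => (2 * Real.sin ψ) •
      ∫ h : unitaryGroupOfForm (starRingEnd ℂ) ((Matrix.diagonal a).map w.1.embedding),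
        g (((h * ⟨circleDiagonal 2 ![z * Circle.exp ψ, z * Circle.exp (-ψ)], circleDiagonal_mem_archLocal_diagonal L 2 a w _⟩ * h⁻¹ :
          unitaryGroupOfForm (starRingEnd ℂ) ((Matrix.diagonal a).map w.1.embedding)) : GL (Fin 2) ℂ) : Matrix (Fin 2) (Fin 2) ℂ) ∂μ := fun g => funext (hF g)
  constructor
  · have key := tendsto_iteratedDeriv_even_of_ladder _ _ _ (isOpen_Ioo.inter isOpen_compl_singleton) hlad hT (l := 𝓝[>] (0 : ℝ)) (nhdsGT_le_nhdsNE 0 hmem)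
      (Λ := fun g : {g : Matrix (Fin 2) (Fin 2) ℂ → E // ContDiff ℝ ∞ g ∧ HasCompactSupport g} => C₁ • ∫ p in Ioi (0 : ℝ) ×ˢ Ioc (0 : ℝ) (2 * π),
            g.1 (Matrix.diagonal ![(((Real.sqrt |(w.1.embedding (a 0)).re|)⁻¹ : ℝ) : ℂ), (((Real.sqrt |(w.1.embedding (a 1)).re|)⁻¹ : ℝ) : ℂ)] *
              ((z : ℂ) • (1 : Matrix (Fin 2) (Fin 2) ℂ) + p.1 • Matrix.diagonal ![(z : ℂ) * I, -((z : ℂ) * I)] +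
                p.1 • !![(0 : ℂ), -((z : ℂ) * I) * cexp (-((p.2 : ℂ) * I)); ((z : ℂ) * I) * cexp ((p.2 : ℂ) * I), 0]) *
              Matrix.diagonal ![((Real.sqrt |(w.1.embedding (a 0)).re| : ℝ) : ℂ), ((Real.sqrt |(w.1.embedding (a 1)).re| : ℝ) : ℂ)]))
      (fun g => by rw [hFg]; exact (hK g.1 g.2.1.continuous g.2.2 z).1) k ⟨f, hf, hfc⟩
    simpa only [hval] using key
  · have key := tendsto_iteratedDeriv_even_of_ladder _ _ _ (isOpen_Ioo.inter isOpen_compl_singleton) hlad hT (l := 𝓝[<] (0 : ℝ)) (nhdsLT_le_nhdsNE 0 hmem)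
      (Λ := fun g : {g : Matrix (Fin 2) (Fin 2) ℂ → E // ContDiff ℝ ∞ g ∧ HasCompactSupport g} => C₁ • -(∫ p in Ioi (0 : ℝ) ×ˢ Ioc (0 : ℝ) (2 * π),
            g.1 (Matrix.diagonal ![(((Real.sqrt |(w.1.embedding (a 0)).re|)⁻¹ : ℝ) : ℂ), (((Real.sqrt |(w.1.embedding (a 1)).re|)⁻¹ : ℝ) : ℂ)] *
              ((z : ℂ) • (1 : Matrix (Fin 2) (Fin 2) ℂ) + p.1 • Matrix.diagonal ![-((z : ℂ) * I), (z : ℂ) * I] +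
                p.1 • !![(0 : ℂ), ((z : ℂ) * I) * cexp (-((p.2 : ℂ) * I)); -((z : ℂ) * I) * cexp ((p.2 : ℂ) * I), 0]) *
              Matrix.diagonal ![((Real.sqrt |(w.1.embedding (a 0)).re| : ℝ) : ℂ), ((Real.sqrt |(w.1.embedding (a 1)).re| : ℝ) : ℂ)])))
      (fun g => by rw [hFg]; exact (hK g.1 g.2.1.continuous g.2.2 z).2) k ⟨f, hf, hfc⟩
    simpa only [hval] using key

end ClosedForms

/-! ## §4 `E = ℂ`: the jumps of every jet in the ★-carpet `HasOneSidedJump` currency -/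

section Jumps

variable (L : Type) [Field L] (a : Fin 2 → L) (w : {w : InfinitePlace L // IsComplex w})

/-- **THE JUMPS OF ALL THE JETS OF THE NORMALISED ELLIPTIC ORBITAL INTEGRAL ON `U(e₀,e₁)`** (`E = ℂ`, ★ `HasOneSidedJump` currency): one `C₁ > 0` (★ (K0±)'s) such that for every
`z ∈ S¹`, `f ∈ C_c^∞(M₂(ℂ), ℂ)` and `k`: the jet of order `2k+1` has both one-sided limits and jump `0` (it is continuous through the wall), the jet of order `2k` has both one-sided
limits and jumps by `(−1)ᵏ · C₁ ·` (the integral of `(1+Ω)ᵏ f` over `T⁻¹·(nilpotent cone at z·1)·T`, both nappes, `T = diag(√|e₀|, √|e₁|)`) — the order-0 jump ★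
`exists_hasOneSidedJump_two_sin_mul_orbitalIntegral_weights` at every order. [cite: Varadarajan1989, §6.4 Thms 23–24] [cite: Shelstad1979, Lemma 4.3 p. 25; Prop. 4.5 p. 26]
[cite: Bouaziz1994IntegralesOrbitales, §3.2 (I₃) p. 580] -/
theorem exists_hasOneSidedJump_iteratedDeriv_orbitalIntegral
    (ha : ∀ i, a i ≠ 0) (hreal : ∀ i, (w.1.embedding (a i)).im = 0) (hsgn : (w.1.embedding (a 0)).re * (w.1.embedding (a 1)).re < 0)
    {p q : ℝ} (hpq : p * q = 1) (hqe : (q : ℂ) ^ 2 * w.1.embedding (a 1) = -w.1.embedding (a 0))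
    [MeasurableSpace (unitaryGroupOfForm (starRingEnd ℂ) ((Matrix.diagonal a).map w.1.embedding))]
    [BorelSpace (unitaryGroupOfForm (starRingEnd ℂ) ((Matrix.diagonal a).map w.1.embedding))]
    (μ : Measure (unitaryGroupOfForm (starRingEnd ℂ) ((Matrix.diagonal a).map w.1.embedding))) [μ.IsHaarMeasure] [μ.IsMulRightInvariant]
    (Ω : (Matrix (Fin 2) (Fin 2) ℂ → ℂ) → Matrix (Fin 2) (Fin 2) ℂ → ℂ)
    (hΩ : ∀ (g : Matrix (Fin 2) (Fin 2) ℂ → ℂ) (Y : Matrix (Fin 2) (Fin 2) ℂ), Ω g Y =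
      -(fderiv ℝ (fderiv ℝ g) Y (Y * !![I, 0; 0, -I]) (Y * !![I, 0; 0, -I]) + fderiv ℝ g Y (Y * !![I, 0; 0, -I] * !![I, 0; 0, -I])) +
        (fderiv ℝ (fderiv ℝ g) Y (Y * !![(0 : ℂ), (p : ℂ); (q : ℂ), 0]) (Y * !![(0 : ℂ), (p : ℂ); (q : ℂ), 0]) +
          fderiv ℝ g Y (Y * !![(0 : ℂ), (p : ℂ); (q : ℂ), 0] * !![(0 : ℂ), (p : ℂ); (q : ℂ), 0])) +
        (fderiv ℝ (fderiv ℝ g) Y (Y * !![(0 : ℂ), -((p : ℂ) * I); (q : ℂ) * I, 0]) (Y * !![(0 : ℂ), -((p : ℂ) * I); (q : ℂ) * I, 0]) +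
          fderiv ℝ g Y (Y * !![(0 : ℂ), -((p : ℂ) * I); (q : ℂ) * I, 0] * !![(0 : ℂ), -((p : ℂ) * I); (q : ℂ) * I, 0]))) :
    ∃ C₁ : ℝ, 0 < C₁ ∧ ∀ (z : Circle) (F : (Matrix (Fin 2) (Fin 2) ℂ → ℂ) → ℝ → ℂ)
      (hF : ∀ (g : Matrix (Fin 2) (Fin 2) ℂ → ℂ) (ψ : ℝ), F g ψ = (2 * Real.sin ψ) •
        ∫ h : unitaryGroupOfForm (starRingEnd ℂ) ((Matrix.diagonal a).map w.1.embedding),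
          g (((h * ⟨circleDiagonal 2 ![z * Circle.exp ψ, z * Circle.exp (-ψ)], circleDiagonal_mem_archLocal_diagonal L 2 a w _⟩ * h⁻¹ :
            unitaryGroupOfForm (starRingEnd ℂ) ((Matrix.diagonal a).map w.1.embedding)) : GL (Fin 2) ℂ) : Matrix (Fin 2) (Fin 2) ℂ) ∂μ)
      {f : Matrix (Fin 2) (Fin 2) ℂ → ℂ}, ContDiff ℝ ∞ f → HasCompactSupport f → ∀ k : ℕ,
        HasOneSidedJump (fun ψ : ℝ => iteratedDeriv (2 * k + 1) (F f) ψ) 0 ∧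
        HasOneSidedJump (fun ψ : ℝ => iteratedDeriv (2 * k) (F f) ψ)
          ((-1 : ℂ) ^ k * (C₁ : ℂ) * ((∫ p in Ioi (0 : ℝ) ×ˢ Ioc (0 : ℝ) (2 * π),
            ((fun g => g + Ω g)^[k] f) (Matrix.diagonal ![(((Real.sqrt |(w.1.embedding (a 0)).re|)⁻¹ : ℝ) : ℂ), (((Real.sqrt |(w.1.embedding (a 1)).re|)⁻¹ : ℝ) : ℂ)] *
              ((z : ℂ) • (1 : Matrix (Fin 2) (Fin 2) ℂ) + p.1 • Matrix.diagonal ![(z : ℂ) * I, -((z : ℂ) * I)] +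
                p.1 • !![(0 : ℂ), -((z : ℂ) * I) * cexp (-((p.2 : ℂ) * I)); ((z : ℂ) * I) * cexp ((p.2 : ℂ) * I), 0]) *
              Matrix.diagonal ![((Real.sqrt |(w.1.embedding (a 0)).re| : ℝ) : ℂ), ((Real.sqrt |(w.1.embedding (a 1)).re| : ℝ) : ℂ)])) +
            ∫ p in Ioi (0 : ℝ) ×ˢ Ioc (0 : ℝ) (2 * π),
            ((fun g => g + Ω g)^[k] f) (Matrix.diagonal ![(((Real.sqrt |(w.1.embedding (a 0)).re|)⁻¹ : ℝ) : ℂ), (((Real.sqrt |(w.1.embedding (a 1)).re|)⁻¹ : ℝ) : ℂ)] *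
              ((z : ℂ) • (1 : Matrix (Fin 2) (Fin 2) ℂ) + p.1 • Matrix.diagonal ![-((z : ℂ) * I), (z : ℂ) * I] +
                p.1 • !![(0 : ℂ), ((z : ℂ) * I) * cexp (-((p.2 : ℂ) * I)); -((z : ℂ) * I) * cexp ((p.2 : ℂ) * I), 0]) *
              Matrix.diagonal ![((Real.sqrt |(w.1.embedding (a 0)).re| : ℝ) : ℂ), ((Real.sqrt |(w.1.embedding (a 1)).re| : ℝ) : ℂ)]))) := by
  obtain ⟨C, -, hodd⟩ := exists_tendsto_iteratedDeriv_odd_orbitalIntegral (E := ℂ) L a w ha hreal hsgn hpq hqe μ Ω hΩ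
  obtain ⟨C₁, hC₁, heven⟩ := exists_tendsto_iteratedDeriv_even_orbitalIntegral_nhdsGT_nhdsLT (E := ℂ) L a w ha hreal hsgn hpq hqe μ Ω hΩ
  refine ⟨C₁, hC₁, fun z F hF f hf hfc k => ⟨?_, ?_⟩⟩
  · have h := hodd z F hF hf hfc k
    exact ⟨_, _, h.mono_left (nhdsGT_le_nhdsNE 0), h.mono_left (nhdsLT_le_nhdsNE 0), sub_self _⟩
  · obtain ⟨hp, hm⟩ := heven z F hF hf hfc k
    refine ⟨_, _, hp, hm, ?_⟩
    simp only [Complex.real_smul, smul_neg]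
    push_cast
    ring

end Jumps

end Literature.NumberTheory.Automorphic.RankOneCasimir

end
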